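import Summits.HodgeConjecture.HodgeConjecture.Theorems.F0P3KitOfRecord                      -- ★ p822184 (K0, p04 (g7)): `kitOfRecord`, `GHSide`, `XiSide`, `cptXi₀` (+ ★ p821569 `TestS₀`, `chS₀`; ★ p820882 `archPacketOfRecord`)
import Summits.HodgeConjecture.HodgeConjecture.Theorems.F0P3bLocalExpansionOfProductFormV6   -- (this desk, EDITION V6 of ★ p821766): `localExpansion_of_productForm`
import HarnessLib

/-!
# `F0P3bLocalExpansionAtKitOfRecord` — law (L6) `LocalExpansion` AT THE KIT OF RECORD `𝔠₀ = kitOfRecord …` from two PRODUCT-TRACE clauses on `gh`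

F0P3b desk (planner F0P3b-plan (g7), «ENGINE local packets», NAMING-ORDER-F0 v2 #7), row 14 of `PLAN.F0P3g5` («localExpansion → F0P3b desk»), for K7∕K8
(RULING (V37)(3): the G∕H-side `S`-carriers `TestSG TestSH tensG tensH trGS trHS MatchesS` are ONE bundled K0 parameter `gh : GHSide …`).

WHAT IS PROVED.  At `𝔠₀ = kitOfRecord L H ι T hT μ 𝔰 gh ξd μω c jInf dsInf archTr ν μv ramCls₀` (★ K0) the character `chS₀ archTr μv` IS a product of local
characters (★ `chS₀`, DEFINITIONAL: `archTr x_ι f′_∞ · ∏_{v ∈ S} Tr x_v(f′_v)`), the sign `sgnG = c` and the archimedean packet `packInf = archPacketOfRecord ι μω jInf dsInf`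
are pinned, so the kit-parametric algebra of (14.6.3) (`localExpansion_of_productForm`, EDITION V6) specialises: **law (L6) holds at `𝔠₀` as soon as `c = ±1`
(R-21: `c = ∏_v c_v`, p. 243 l. 9 – p. 244 l. 4) and the bundled `gh` satisfies the two PRODUCT-TRACE CLAUSES of print** —
* `GTraceProductForm` (G-side, F0P3a currency): under `MatchesS S fS fSG fSH`, `Tr Π(ξ)_S(f_{S,G}) = [cptXi₀ ξ] · (−1)^N · (A πⁿ_ι − A πˢ_ι) · ∏_{v ∈ S} (Tr πⁿ_v − Tr πˢ_v)(f′_v)`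
  — the stable packet character [Rogawski1990, 13.1.3 (b) p. 199; 12.3.3 (b) p. 178; Prop. 14.4.1 (a); p. 244 ll. 6–17], i.e. the DEFINITION of the `S`-level packet trace of record;
* `HTraceProductForm` (H-side, F0P3b currency): under `MatchesS S fS fSG fSH`, `Tr ξ_S(f^H_S) = [cptXi₀ ξ] · (−1)^N · c · (A πⁿ_ι + A πˢ_ι) · ∏_{v ∈ S} (Tr πⁿ_v + Tr πˢ_v)(f′_v)`
  — the endoscopic character identities [Rogawski1990, Prop. 13.1.4 p. 199 (= ★ `CMCharIdentityPackage`, Q_CM, at the (J2′) kit); 12.3.3 (a) p. 178; Prop. 14.4.2 (c); p. 244 ll. 6–17],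
with `A := fun y => archTr y f′_∞` (the archimedean character, parameter `archTr`, D8-1) and `N := nCompactOfRecord L`.
So K7 (`ghOfRecord`, F0P3a: `trGS₀` := the product of local packet traces ⇒ `GTraceProductForm` by `rfl`∕`simp`) and K8 (F0P3b: `trHS₀`, `MatchesS₀ ⊇ IsLocalDeltaTransfer`,
Q_CM by name + the archimedean clause D8) discharge (L6) WITHOUT touching the expansion algebra again.

No `sorry`, no new axiom, no instance, no notation; Theorems never import Lines.
HONEST LABEL: HC_CM is proved only modulo the printed citations until rung 0 closes.
-/

set_option autoImplicit false
set_option linter.dupNamespace false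

noncomputable section

open NumberField IsDedekindDomain MeasureTheory
open Literature.NumberTheory.Rogawski1990 Literature.NumberTheory.GaloisRepresentations
open Literature.NumberTheory.Automorphic Literature.NumberTheory.Automorphic.UnitaryGroup
open scoped Matrix ComplexOrder BigOperators Classical

namespace Summit.HodgeConjecture.HodgeConjecture.Cruxes.H413.F0P3bLocalExpansionAtKitOfRecord

open Summit.HodgeConjecture.HodgeConjecture.Cruxes.H413.F0P3InnerFormClassificationV6
open Summit.HodgeConjecture.HodgeConjecture.Cruxes.H413.F0P3InnerFormClassificationV6.ClassificationKit (memberCoeff)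
open Summit.HodgeConjecture.HodgeConjecture.Cruxes.H413.F0P3SemilocalTestFunctionsOfRecord (TestS₀ chS₀ chS₀_def)
open Summit.HodgeConjecture.HodgeConjecture.Cruxes.H413.F0P3XiArchDataOfRecord (nCompactOfRecord)
open Summit.HodgeConjecture.HodgeConjecture.Cruxes.H413.F0P3XiArchPacketOfRecord (archPacketOfRecord)
open Summit.HodgeConjecture.HodgeConjecture.Cruxes.H413.F0P3KitOfRecord (GHSide XiSide cptXi₀ kitOfRecord)
open Summit.HodgeConjecture.HodgeConjecture.Cruxes.H413.F0P3bLocalExpansionOfProductFormV6 (localExpansion_of_productForm finite_support_expansion_mul)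

variable (L : Type) [Field L] [NumberField L] [IsCMField L] (H : Matrix (Fin 3) (Fin 3) L) (ι : L →+* ℂ) (T : GL (Fin 3) ℂ)
  (hT : (T : Matrix (Fin 3) (Fin 3) ℂ)ᴴ * H.map ι * (T : Matrix (Fin 3) (Fin 3) ℂ) = Literature.Geometry.ComplexHyperbolic.BallModel.J)
  (μ : Measure (Gp L H).automorphicQuotient) [(Gp L H).IsAutomorphicMeasure μ]
  [MeasurableSpace (Gp L H).Adelic] [BorelSpace (Gp L H).Adelic]

/-! ## §1 The two product-trace clauses on the bundled G∕H side `gh` -/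

section Clauses

variable {L H μ}
variable {PG PH : Type} (gh : GHSide L H ι T hT PG PH) (ξd : XiSide L H PG PH)
  (μω : HeckeCharacter L) (c : ℚ) (jInf dsInf : ℤ → ℤ → ℤ → Cinf)
  (archTr : Cinf → (UnitaryGroup.arch (↥(maximalRealSubfield L)) L (IsCMField.complexConj L) 3 H → ℂ) → ℂ)

/-- **`GTraceProductForm`** — the G-side PRODUCT-TRACE clause: off `ram ξ`, for matched local data, the `S`-level trace of the packet `Π(ξ)` is the compact
factor times `(−1)^N` times the STABLE packet characters `(A πⁿ_ι − A πˢ_ι) · ∏_{v ∈ S} (Tr πⁿ_v − Tr πˢ_v)(f′_v)` (signed member sums, `ε = −1`).  At the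
G-side carriers of record this is the definition of `trGS₀` (F0P3a, K7). [cite: Rogawski1990, §13.1 13.1.3 (b) p. 199; §12.3 12.3.3 (b) p. 178; §14.6 p. 244] -/
def GTraceProductForm (μv : ∀ v : Places L, @Measure ((cmDatum L 3 H).Local v) (borel _)) : Prop :=
  ∀ (ξ : OneDimAutRepH L) (S : Finset (Places L)), ξd.ram ξ ⊆ S →
    ∀ (fS : TestS₀ L H ι T hT S) (fSG : gh.TestSG S) (fSH : gh.TestSH S), gh.MatchesS S fS fSG fSH →
      gh.trGS S (ξd.PiXi ξ) fSG = (if cptXi₀ ι μω ξ then 1 else 0) * (-1) ^ nCompactOfRecord L *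
        ((∑ᶠ y, (memberCoeff (archPacketOfRecord ι μω jInf dsInf ξ) (-1) y : ℂ) * archTr y fS.arch) *
          ∏ v : ↥S, ∑ᶠ z, (memberCoeff (ξd.packFin ξ v.1) (-1) z : ℂ) *
            (letI : MeasurableSpace ((cmDatum L 3 H).Local v.1) := borel _; z.smoothTrace (μv v.1) (fS.loc v)))

/-- **`HTraceProductForm`** — the H-side PRODUCT-TRACE clause: off `ram ξ`, for matched local data, the `S`-level trace of `ξ_S(f^H_S)` is the compact factor
times `(−1)^N · c` times the ENDOSCOPIC sums `(A πⁿ_ι + A πˢ_ι) · ∏_{v ∈ S} (Tr πⁿ_v + Tr πˢ_v)(f′_v)` (`ε = 1`) — the content of the character identities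
Prop. 13.1.4 (★ `CMCharIdentityPackage`, Q_CM) and 12.3.3 (a), and of `c = ∏ c_v`.  F0P3b currency (K8: `trHS₀`, `MatchesS₀`, the archimedean clause D8).
[cite: Rogawski1990, §13.1 Prop. 13.1.4 p. 199; §12.3 12.3.3 (a) p. 178; §14.6 p. 243 l. 9 – p. 244 l. 17] -/
def HTraceProductForm (μv : ∀ v : Places L, @Measure ((cmDatum L 3 H).Local v) (borel _)) : Prop :=
  ∀ (ξ : OneDimAutRepH L) (S : Finset (Places L)), ξd.ram ξ ⊆ S →
    ∀ (fS : TestS₀ L H ι T hT S) (fSG : gh.TestSG S) (fSH : gh.TestSH S), gh.MatchesS S fS fSG fSH →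
      gh.trHS S (ξd.ρXi ξ) fSH = (if cptXi₀ ι μω ξ then 1 else 0) * (-1) ^ nCompactOfRecord L * (c : ℂ) *
        ((∑ᶠ y, (memberCoeff (archPacketOfRecord ι μω jInf dsInf ξ) 1 y : ℂ) * archTr y fS.arch) *
          ∏ v : ↥S, ∑ᶠ z, (memberCoeff (ξd.packFin ξ v.1) 1 z : ℂ) *
            (letI : MeasurableSpace ((cmDatum L 3 H).Local v.1) := borel _; z.smoothTrace (μv v.1) (fS.loc v)))

end Clauses

/-! ## §2 (L6) at `𝔠₀` -/

section AtKitOfRecord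

variable (𝔰 : Sockets L H μ) (gh : GHSide L H ι T hT 𝔰.PacketG 𝔰.PacketH) (ξd : XiSide L H 𝔰.PacketG 𝔰.PacketH)
  (μω : HeckeCharacter L) (c : ℚ) (jInf dsInf : ℤ → ℤ → ℤ → Cinf)
  (archTr : Cinf → (UnitaryGroup.arch (↥(maximalRealSubfield L)) L (IsCMField.complexConj L) 3 H → ℂ) → ℂ)
  (ν : Measure (Gp L H).Adelic) [IsFiniteMeasureOnCompacts ν]
  (μv : ∀ v : Places L, @Measure ((cmDatum L 3 H).Local v) (borel _))
  (ramCls₀ : DiscreteAutomorphicRep (Gp L H) μ → Set (Places L))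

/-- The character of record is a product of local characters (DEFINITIONAL, ★ `chS₀`). [cite: Rogawski1990, §14.5 p. 237] -/
theorem chS_kitOfRecord_productForm (S : Finset (Places L)) (fS : TestS₀ L H ι T hT S) (x : LocS L H S) :
    (kitOfRecord L H ι T hT μ 𝔰 gh ξd μω c jInf dsInf archTr ν μv ramCls₀).chS S x fS =
      (fun y : Cinf => archTr y fS.arch) x.1 *
        ∏ v : ↥S, (fun (v : ↥S) (z : IrrClass ((cmDatum L 3 H).Local v.1)) =>
          (letI : MeasurableSpace ((cmDatum L 3 H).Local v.1) := borel _; z.smoothTrace (μv v.1) (fS.loc v))) v (x.2 v) :=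
  rfl

/-- The first conjunct of (L6) at `𝔠₀` — finiteness of the support of `x ↦ E_ξ(x) · ch_x(f_S)` — holds with NO hypothesis. [cite: Rogawski1990, §14.6 p. 244] -/
theorem finite_support_expansion_mul_kitOfRecord (ξ : OneDimAutRepH L) (S : Finset (Places L)) (fS : TestS₀ L H ι T hT S) :
    (Function.support fun x : LocS L H S =>
      ((kitOfRecord L H ι T hT μ 𝔰 gh ξd μω c jInf dsInf archTr ν μv ramCls₀).expansion ξ S x : ℂ) *
        (kitOfRecord L H ι T hT μ 𝔰 gh ξd μω c jInf dsInf archTr ν μv ramCls₀).chS S x fS).Finite :=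
  finite_support_expansion_mul _ ξ S _

/-- **(L6) AT THE KIT OF RECORD.**  If the one global sign is `c = ±1` (R-21) and the bundled G∕H side `gh` satisfies the two product-trace clauses
`GTraceProductForm` (stable packet characters) and `HTraceProductForm` (endoscopic character identities), then law (L6) `LocalExpansion` — both conjuncts,
at every `ξ`, `S ⊇ ram ξ` and matched `(f_S, f_{S,G}, f^H_S)` — holds at `𝔠₀ = kitOfRecord …`: the two-term expansion (14.6.3)
`½ Tr Π(ξ)_S(f_S) + ½ Tr ξ_S(f^H_S) = Σ_x E_ξ(x) · ch_x(f_S)`. [cite: Rogawski1990, §14.6 Thm. 14.6.4, (14.6.3) p. 244 ll. 6–17; §13.1 p. 199; §12.3 p. 178] -/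
theorem localExpansion_kitOfRecord (hc : c = 1 ∨ c = -1)
    (hG : GTraceProductForm ι T hT gh ξd μω jInf dsInf archTr μv) (hH : HTraceProductForm ι T hT gh ξd μω c jInf dsInf archTr μv) :
    (kitOfRecord L H ι T hT μ 𝔰 gh ξd μω c jInf dsInf archTr ν μv ramCls₀).LocalExpansion :=
  localExpansion_of_productForm _ (fun _ _ _ => hc) fun ξ S hS fS fSG fSH hm =>
    ⟨fun y => archTr y fS.arch,
      fun v z => (letI : MeasurableSpace ((cmDatum L 3 H).Local v.1) := borel _; z.smoothTrace (μv v.1) (fS.loc v)),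
      fun _ => rfl, hG ξ S hS fS fSG fSH hm, hH ξ S hS fS fSG fSH hm⟩

end AtKitOfRecord

end Summit.HodgeConjecture.HodgeConjecture.Cruxes.H413.F0P3bLocalExpansionAtKitOfRecord

end
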